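import Literature.Probability.RandomPlanarGeometry.SAWSurgery
import HarnessLib

/-!
# Self-avoiding walk on `ℤ^{d+2}`: the multi-site cube surgery of Kesten's pattern theorem

Continuation of `SAWSurgery.lean` (single-site splice at a `SurgerySite`), formalising the
replacement map of the proof of Kesten's pattern theorem as printed in N. Madras, G. Slade,
*The Self-Avoiding Walk* (1993), §7.2, proof of Lemma 7.2.6 (and re-used in the proof of
Theorem 7.2.3): given a self-avoiding walk `ω` of length `N` and well separated sites
`j₁ > j₂ > ⋯ > j_s` at each of which all visits to the cube `ω(j) + [-R,R]^{d+2}` happen in the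
time window `[j - m, j + m]`, replace, at every site, the piece of `ω` between the first and the
last visit to the cube by a prescribed self-avoiding route inside the cube ("replace the portion
of the walk inside each cube by a walk on which the event occurs", (7.2.17)–(7.2.19)); and the
fact that `ω` is recovered from the new walk together with the removed pieces ("given the
resulting walk and the cubes, the original walk is determined by the pieces removed").

## Contents (namespace `Literature.Probability.RandomPlanarGeometry.SAW.Zd`)

* `RouteProvider d R Λ` — a choice of self-avoiding route of length `≤ Λ` inside a radius-`R`
  cube between two distinct outer-layer points (instances come from `SAWCubeRouting.exists_route`,
  `R = 13`, and `SAWSnakeRoute.exists_snake_route`, `R = 30`);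
* `op ρ (N, ω) j` — the single-site operation (splice the route between first and last visit);
  `Phi ρ (N, ω) [j₁, …, j_s]` — the operations applied along the list (head first);
  `op_eq`, `op_mem_saws` (the result is a self-avoiding walk of length
  `σ + L + (N - τ) ∈ [N - 2m, N + Λ]`), `op_apply_of_le` (times `≤ σ` untouched), `op_point`
  (every point of the new walk is an old point or lies in the cube), `op_apply_route_after`
  (the route block and the shifted tail), `op_preserves` (an EARLIER, far-away surgery site stays
  a surgery site with the same window);
* `Valid m R N ω js` — the list is made of surgery sites with windows `[j-m, j+m]`, pairwise
  gaps `b + 2m + 1 ≤ a` (list strictly decreasing) and centres pairwise `> 2R` apart in sup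
  norm; `Valid.op_cons`; `Phi_spec` (self-avoiding, `N - 2ms ≤ |Φ| ≤ N + Λ s`, points old or in
  one of the cubes);
* `UndoData`, `undo`, `Decode`, `undoDataOf`, `dataList`, `undo_op`, **`Decode_Phi`** — the
  decoding `Decode (Phi ρ (N, ω) js) (dataList ρ (N, ω) js) = (N, ω)` (injectivity given the
  removed pieces and the cube centres);
* `firstVisit_congr`, `lastVisit_congr`, `site_data_op`, `Phi_suffix`, **`Phi_blocks`** — the
  route spliced in at each listed site survives on the final walk as a block of consecutive
  times (so the event created in each cube does occur on `Φ(ω)`).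

Everything is proved; no named facts.
-/

noncomputable section

open Filter Topology Literature.Probability.LatticeModels Literature.Probability.Percolation SimpleGraph
open scoped BigOperators

namespace Literature.Probability.RandomPlanarGeometry.SAW.Zd

/-! ### Route providers and the single-site operation -/

section Op

variable {d : ℕ}

/-- A **route provider** for radius `R` with length bound `Λ`: to a centre `c` and two distinct
points `x ≠ y` of the outer layer of `c + [-R,R]^{d+2}` it assigns a self-avoiding path inside
the cube from `x` to `y` of length `≤ Λ`. (Instances: the `(V,Q)`-route of `SAWCubeRouting`,
`R = 13`, and the snake route of `SAWSnakeRoute`, `R = 30`.) [folklore] -/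
structure RouteProvider (d : ℕ) (R : ℤ) (Λ : ℕ) where
  /-- the length of the route -/
  len : Site (d + 2) → Site (d + 2) → Site (d + 2) → ℕ
  /-- the route -/
  path : Site (d + 2) → Site (d + 2) → Site (d + 2) → ℕ → Site (d + 2)
  /-- its properties, under the hypotheses of the routing theorems -/
  spec : ∀ c x y, (∀ k, |x k - c k| ≤ R) → (∃ k, |x k - c k| = R) → (∀ k, |y k - c k| ≤ R) →
    (∃ k, |y k - c k| = R) → x ≠ y →
    len c x y ≤ Λ ∧ path c x y 0 = x ∧ path c x y (len c x y) = y ∧ PathOn (len c x y) (path c x y) ∧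
      ∀ t ≤ len c x y, ∀ k, |path c x y t k - c k| ≤ R

variable {R : ℤ} {Λ : ℕ} (ρ : RouteProvider d R Λ) (m : ℕ)

open Classical in
/-- **The single-site operation** at the site `j` of the walk `ω` of length `N`: splice the
provided route between the first and the last visit to the cube `ω(j) + [-R,R]^{d+2}`; returns
the new length and the new walk. (Meaningful when `j` is a surgery site with window
`[j - m, j + m]`.) [cite: MadrasSlade1993, Lemma 7.2.6 (proof)] -/
def op (Nω : ℕ × (ℕ → Site (d + 2))) (j : ℕ) : ℕ × (ℕ → Site (d + 2)) :=
  let N := Nω.1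
  let ω := Nω.2
  if h : ∃ t, InBall R (ω j) (ω t) then
    let σ := firstVisit R (ω j) ω h
    let τ := lastVisit R (ω j) ω N
    let L := ρ.len (ω j) (ω σ) (ω τ)
    (σ + L + (N - τ), splice ω σ τ L (ρ.path (ω j) (ω σ) (ω τ)))
  else Nω

/-- **The multi-site operation**: apply `op` along a list of sites (intended: strictly
decreasing, well separated). [cite: MadrasSlade1993, Lemma 7.2.6 (proof)] -/
def Phi : ℕ × (ℕ → Site (d + 2)) → List ℕ → ℕ × (ℕ → Site (d + 2))
  | Nω, [] => Nω
  | Nω, j :: rest => Phi (op ρ Nω j) rest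

/-- The data needed to undo one operation: the centre of the cube, the length of the removed
piece and the removed piece translated to the origin. [folklore] -/
structure UndoData (d : ℕ) where
  /-- centre of the cube -/
  c : Site (d + 2)
  /-- length of the removed piece -/
  len : ℕ
  /-- the removed piece, translated to start at `0` -/
  piece : ℕ → Site (d + 2)

open Classical in
/-- **Undo one operation**: locate the cube around `c` by the first and last visits of `ψ` and
splice the old piece back. [folklore] -/
def undo (Nψ : ℕ × (ℕ → Site (d + 2))) (D : UndoData d) : ℕ × (ℕ → Site (d + 2)) :=
  let N := Nψ.1
  let ψ := Nψ.2
  if h : ∃ t, InBall R D.c (ψ t) then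
    let α := firstVisit R D.c ψ h
    let β := lastVisit R D.c ψ N
    (α + D.len + (N - β), splice ψ α β D.len fun s => ψ α + D.piece s)
  else Nψ

/-- **Decoding**: undo the operations along a list of data, the head being undone last.
[folklore] -/
def Decode : ℕ × (ℕ → Site (d + 2)) → List (UndoData d) → ℕ × (ℕ → Site (d + 2))
  | Nψ, [] => Nψ
  | Nψ, D :: rest => undo (R := R) (Decode Nψ rest) D

open Classical in
/-- The undo-data of the site `j` of `(N, ω)` (for the cube radius `R`). [folklore] -/
def undoDataOf (R : ℤ) (Nω : ℕ × (ℕ → Site (d + 2))) (j : ℕ) : UndoData d :=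
  let N := Nω.1
  let ω := Nω.2
  if h : ∃ t, InBall R (ω j) (ω t) then
    let σ := firstVisit R (ω j) ω h
    let τ := lastVisit R (ω j) ω N
    ⟨ω j, τ - σ, fun s => ω (σ + s) - ω σ⟩
  else ⟨ω j, 0, fun _ => 0⟩

/-- The list of undo-data along a list of sites (each computed on the current walk). [folklore] -/
def dataList : ℕ × (ℕ → Site (d + 2)) → List ℕ → List (UndoData d)
  | _, [] => []
  | Nω, j :: rest => undoDataOf R Nω j :: dataList (op ρ Nω j) rest

end Op

/-! ### The single-site operation at a surgery site -/

section OpSpec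

variable {d : ℕ} {R : ℤ} {Λ m N j : ℕ} (ρ : RouteProvider d R Λ) {ω : ℕ → Site (d + 2)}

/-- Two cubes of radius `R` whose centres are more than `2R` apart in some coordinate are
disjoint. [folklore] -/
theorem not_inBall_of_apart {c c' z : Site (d + 2)} (h : ∃ k, 2 * R < |c k - c' k|) (hz : InBall R c z) :
    ¬ InBall R c' z := by
  intro hz'
  obtain ⟨k, hk⟩ := h
  have h1 := hz k; have h2 := hz' k
  have : |c k - c' k| ≤ |z k - c k| + |z k - c' k| := by
    calc |c k - c' k| = |(z k - c' k) - (z k - c k)| := by ring_nf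
      _ ≤ |z k - c' k| + |z k - c k| := abs_sub _ _
      _ = _ := add_comm _ _
  linarith

variable (h : SurgerySite ω N R j (j - m) (j + m))
include h

/-- Unfolding `op` at a surgery site. [folklore] -/
theorem op_eq :
    op ρ (N, ω) j = (firstVisit R (ω j) ω h.exists_visit + ρ.len (ω j) (ω (firstVisit R (ω j) ω h.exists_visit))
      (ω (lastVisit R (ω j) ω N)) + (N - lastVisit R (ω j) ω N),
      splice ω (firstVisit R (ω j) ω h.exists_visit) (lastVisit R (ω j) ω N)
        (ρ.len (ω j) (ω (firstVisit R (ω j) ω h.exists_visit)) (ω (lastVisit R (ω j) ω N)))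
        (ρ.path (ω j) (ω (firstVisit R (ω j) ω h.exists_visit)) (ω (lastVisit R (ω j) ω N)))) := by
  unfold op
  simp only [dif_pos h.exists_visit]

/-- The route data at a surgery site satisfy the hypotheses of the provider. [folklore] -/
theorem route_spec :
    ρ.len (ω j) (ω (firstVisit R (ω j) ω h.exists_visit)) (ω (lastVisit R (ω j) ω N)) ≤ Λ ∧
    ρ.path (ω j) (ω (firstVisit R (ω j) ω h.exists_visit)) (ω (lastVisit R (ω j) ω N)) 0 =
      ω (firstVisit R (ω j) ω h.exists_visit) ∧
    ρ.path (ω j) (ω (firstVisit R (ω j) ω h.exists_visit)) (ω (lastVisit R (ω j) ω N))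
      (ρ.len (ω j) (ω (firstVisit R (ω j) ω h.exists_visit)) (ω (lastVisit R (ω j) ω N))) =
      ω (lastVisit R (ω j) ω N) ∧
    PathOn (ρ.len (ω j) (ω (firstVisit R (ω j) ω h.exists_visit)) (ω (lastVisit R (ω j) ω N)))
      (ρ.path (ω j) (ω (firstVisit R (ω j) ω h.exists_visit)) (ω (lastVisit R (ω j) ω N))) ∧
    ∀ t ≤ ρ.len (ω j) (ω (firstVisit R (ω j) ω h.exists_visit)) (ω (lastVisit R (ω j) ω N)), ∀ k,
      |ρ.path (ω j) (ω (firstVisit R (ω j) ω h.exists_visit)) (ω (lastVisit R (ω j) ω N)) t k - ω j k| ≤ R := by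
  have hjN : j ≤ N := by have := h.j_le; have := h.lt_N; omega
  exact ρ.spec _ _ _ (inBall_firstVisit h.exists_visit) h.entry_outer
    (inBall_lastVisit hjN fun k => by simp [h.nonneg]) h.exit_outer h.entry_ne_exit

/-- **(O1)** The operated walk is a self-avoiding walk of the new length, and the length
bookkeeping. [cite: MadrasSlade1993, Lemma 7.2.6 (proof), (7.2.19)] -/
theorem op_mem_saws :
    (op ρ (N, ω) j).2 ∈ saws (d + 2) (op ρ (N, ω) j).1 ∧
      (op ρ (N, ω) j).1 ≤ N + Λ ∧ N ≤ (op ρ (N, ω) j).1 + 2 * m ∧ j - m ≤ (op ρ (N, ω) j).1 := by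
  obtain ⟨hL, h0, hend, hP, hin⟩ := route_spec ρ h
  rw [op_eq ρ h]
  refine ⟨h.splice_mem_saws hP h0 hend fun t ht => hin t ht, ?_, ?_, ?_⟩
  · have := h.first_spec.2; have := h.last_spec.1; have : lastVisit R (ω j) ω N ≤ N := lastVisit_le
    simp only; omega
  · have := h.first_spec.1; have := h.last_spec.2; have : lastVisit R (ω j) ω N ≤ N := lastVisit_le
    simp only; omega
  · have := h.first_spec.1; simp only; omega

/-- **(O2)** Before the first visit (in particular up to time `j - m`) the walk is unchanged.
[folklore] -/
theorem op_apply_of_le {t : ℕ} (ht : t ≤ firstVisit R (ω j) ω h.exists_visit) : (op ρ (N, ω) j).2 t = ω t := by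
  rw [op_eq ρ h]
  exact splice_of_le ht

/-- **(O5)** Every point of the operated walk is an old point of `ω` at a time `≤ σ` or `≥ τ`
(both `≤ N`), or a route point inside the cube. [folklore] -/
theorem op_point (t : ℕ) :
    (∃ t', (t' ≤ firstVisit R (ω j) ω h.exists_visit ∨ lastVisit R (ω j) ω N ≤ t') ∧ t' ≤ N ∧
        (op ρ (N, ω) j).2 t = ω t') ∨
      (InBall R (ω j) ((op ρ (N, ω) j).2 t) ∧ firstVisit R (ω j) ω h.exists_visit ≤ t ∧
        t ≤ firstVisit R (ω j) ω h.exists_visit + ρ.len (ω j) (ω (firstVisit R (ω j) ω h.exists_visit))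
          (ω (lastVisit R (ω j) ω N))) := by
  obtain ⟨hL, h0, hend, hP, hin⟩ := route_spec ρ h
  rw [op_eq ρ h]
  simp only
  set σ := firstVisit R (ω j) ω h.exists_visit
  set τ := lastVisit R (ω j) ω N
  set L := ρ.len (ω j) (ω σ) (ω τ)
  have hστ : σ < τ := h.first_lt_last
  have hτN : τ ≤ N := lastVisit_le
  rcases le_or_gt t σ with ht | ht
  · exact Or.inl ⟨t, Or.inl ht, by omega, splice_of_le ht⟩
  · rcases le_or_gt t (σ + L) with ht' | ht'
    · obtain ⟨s, rfl⟩ : ∃ s, t = σ + s := ⟨t - σ, by omega⟩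
      right
      rw [splice_piece h0 (by omega)]
      exact ⟨hin s (by omega), by omega, by omega⟩
    · obtain ⟨u, rfl⟩ : ∃ u, t = σ + L + u := ⟨t - σ - L, by omega⟩
      left
      rw [splice_after h0 hend]
      rcases le_or_gt (τ + u) N with hu | hu
      · exact ⟨τ + u, Or.inr (by omega), hu, rfl⟩
      · exact ⟨N, Or.inr hτN, le_rfl, (mem_saws.1 h.mem).2.1 _ hu.le⟩

/-- **(O3)–(O4)**: values on and after the route. [folklore] -/
theorem op_apply_route_after :
    (∀ s ≤ ρ.len (ω j) (ω (firstVisit R (ω j) ω h.exists_visit)) (ω (lastVisit R (ω j) ω N)),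
      (op ρ (N, ω) j).2 (firstVisit R (ω j) ω h.exists_visit + s) =
        ρ.path (ω j) (ω (firstVisit R (ω j) ω h.exists_visit)) (ω (lastVisit R (ω j) ω N)) s) ∧
    ∀ u, (op ρ (N, ω) j).2 (firstVisit R (ω j) ω h.exists_visit +
      ρ.len (ω j) (ω (firstVisit R (ω j) ω h.exists_visit)) (ω (lastVisit R (ω j) ω N)) + u) =
        ω (lastVisit R (ω j) ω N + u) := by
  obtain ⟨hL, h0, hend, hP, hin⟩ := route_spec ρ h
  rw [op_eq ρ h]
  exact ⟨fun s hs => splice_piece h0 hs, fun u => splice_after h0 hend u⟩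

/-- **The invariant**: after the operation at `j`, a surgery site `l` with `l + 2m + 1 ≤ j` and
cube apart from the cube of `j` is still a surgery site, with the same window.
[cite: MadrasSlade1993, Lemma 7.2.6 (proof)] -/
theorem op_preserves {l : ℕ} (hl : SurgerySite ω N R l (l - m) (l + m)) (hlj : l + 2 * m + 1 ≤ j)
    (hap : ∃ k, 2 * R < |ω j k - ω l k|) :
    SurgerySite (op ρ (N, ω) j).2 (op ρ (N, ω) j).1 R l (l - m) (l + m) := by
  obtain ⟨hmem, hlen1, hlen2, hlen3⟩ := op_mem_saws ρ h
  have hσ := h.first_spec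
  have hlσ : l + m + 1 ≤ firstVisit R (ω j) ω h.exists_visit := by omega
  have heq : ∀ t ≤ l + m + 1, (op ρ (N, ω) j).2 t = ω t := fun t ht => op_apply_of_le ρ h (by omega)
  have hll : (op ρ (N, ω) j).2 l = ω l := heq l (by omega)
  refine ⟨hmem, hl.one_le, hl.le_j, hl.j_le, by omega, fun t ht hin => ?_, ?_, hl.nonneg⟩
  · rw [hll] at hin
    rcases op_point ρ h t with ⟨t', ht'στ, ht'N, e⟩ | ⟨hinj, h1, h2⟩
    · rw [e] at hin
      have hw := hl.visits t' ht'N hin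
      rcases ht'στ with ht' | ht'
      · -- old early point: `ψ t = ω t'` with `t' ≤ σ`; then `t = t'`
        have e2 : (op ρ (N, ω) j).2 t = (op ρ (N, ω) j).2 t' := by rw [e, op_apply_of_le ρ h ht']
        have := (mem_saws.1 hmem).2.2.2 (show t ≤ _ from ht) (show t' ≤ (op ρ (N, ω) j).1 by omega) e2
        omega
      · -- old late point: time `t' ≥ τ ≥ j > l + m`, impossible
        have := h.last_spec.1
        omega
    · exact absurd hin (not_inBall_of_apart hap hinj)
  · obtain ⟨t, htN, htl, hin⟩ := hl.rich
    have hw := hl.visits t htN hin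
    exact ⟨t, by omega, htl, by rw [hll, heq t (by omega)]; exact hin⟩

end OpSpec

/-! ### Validity of a list of sites; the multi-site operation -/

section PhiSpec

variable {d : ℕ} {R : ℤ} {Λ m : ℕ} (ρ : RouteProvider d R Λ)

/-- A **valid list of sites** for `(N, ω)`: `ω ∈ S_N`, every listed `j` is a surgery site with
window `[j-m, j+m]`, the list is decreasing with gaps `≥ 2m+1` (disjoint windows, (7.2.17)) and
the cubes are pairwise apart (disjoint, (7.2.18)). [cite: MadrasSlade1993, Lemma 7.2.6 (proof)] -/
structure Valid (m : ℕ) (R : ℤ) (N : ℕ) (ω : ℕ → Site (d + 2)) (js : List ℕ) : Prop where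
  mem : ω ∈ saws (d + 2) N
  site : ∀ j ∈ js, SurgerySite ω N R j (j - m) (j + m)
  gaps : js.Pairwise fun a b => b + 2 * m + 1 ≤ a
  apart : js.Pairwise fun a b => ∃ k, 2 * R < |ω a k - ω b k|

variable {ρ}

/-- Validity passes to the operated walk and the remaining sites. [cite: MadrasSlade1993, Lemma 7.2.6 (proof)] -/
theorem Valid.op_cons {N : ℕ} {ω : ℕ → Site (d + 2)} {j : ℕ} {rest : List ℕ} (hv : Valid m R N ω (j :: rest)) :
    Valid m R (op ρ (N, ω) j).1 (op ρ (N, ω) j).2 rest := by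
  have hj := hv.site j (by simp)
  have hgaps := List.pairwise_cons.1 hv.gaps
  have hapart := List.pairwise_cons.1 hv.apart
  have heq : ∀ l ∈ rest, (op ρ (N, ω) j).2 l = ω l := fun l hl =>
    op_apply_of_le ρ hj (by have := hgaps.1 l hl; have := hj.first_spec.1; omega)
  refine ⟨(op_mem_saws ρ hj).1, fun l hl => op_preserves ρ hj (hv.site l (by simp [hl])) (hgaps.1 l hl) (hapart.1 l hl),
    hgaps.2, ?_⟩
  refine hapart.2.imp_of_mem fun {a b} ha hb hab => ?_
  rw [heq a ha, heq b hb]; exact hab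

/-- **The multi-site operation yields a self-avoiding walk; length bookkeeping; early agreement;
every point is an old point or lies in one of the cubes.** [cite: MadrasSlade1993, Lemma 7.2.6 (proof)] -/
theorem Phi_spec : ∀ (js : List ℕ) {N : ℕ} {ω : ℕ → Site (d + 2)}, Valid m R N ω js →
    (Phi ρ (N, ω) js).2 ∈ saws (d + 2) (Phi ρ (N, ω) js).1 ∧
    (Phi ρ (N, ω) js).1 ≤ N + Λ * js.length ∧ N ≤ (Phi ρ (N, ω) js).1 + 2 * m * js.length ∧
    (∀ t, (∃ t' ≤ N, (Phi ρ (N, ω) js).2 t = ω t') ∨ ∃ j ∈ js, InBall R (ω j) ((Phi ρ (N, ω) js).2 t))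
  | [], N, ω, hv => by
    refine ⟨hv.mem, by simp [Phi], by simp [Phi], fun t => Or.inl ?_⟩
    simp only [Phi]
    rcases le_or_gt t N with h | h
    · exact ⟨t, h, rfl⟩
    · exact ⟨N, le_rfl, (mem_saws.1 hv.mem).2.1 t h.le⟩
  | j :: rest, N, ω, hv => by
    have hj := hv.site j (by simp)
    obtain ⟨hmem1, hl1, hl2, hl3⟩ := op_mem_saws ρ hj
    obtain ⟨hmem, hlen, hlen', hpts⟩ := Phi_spec rest hv.op_cons
    have epair : ((op ρ (N, ω) j).1, (op ρ (N, ω) j).2) = op ρ (N, ω) j := Prod.mk.eta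
    rw [epair] at hmem hlen hlen' hpts
    simp only [Phi, List.length_cons]
    refine ⟨hmem, ?_, ?_, fun t => ?_⟩
    · have : Λ * (rest.length + 1) = Λ * rest.length + Λ := by ring
      omega
    · have : 2 * m * (rest.length + 1) = 2 * m * rest.length + 2 * m := by ring
      omega
    · rcases hpts t with ⟨t', ht', e⟩ | ⟨l, hl, hin⟩
      · rcases op_point ρ hj t' with ⟨t'', -, ht''N, e'⟩ | ⟨hinj, -, -⟩
        · exact Or.inl ⟨t'', ht''N, by rw [e, e']⟩
        · exact Or.inr ⟨j, by simp, by rw [e]; exact hinj⟩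
      · refine Or.inr ⟨l, by simp [hl], ?_⟩
        rwa [op_apply_of_le ρ hj (by have := (List.pairwise_cons.1 hv.gaps).1 l hl; have := hj.first_spec.1; omega)] at hin

/-! ### Undoing and decoding -/

/-- **Undoing one operation recovers the walk** (the cube is located by the first and last visits
of the operated walk, which are `σ` and `σ + L`). [cite: MadrasSlade1993, Lemma 7.2.6 (proof)] -/
theorem undo_op {N : ℕ} {ω : ℕ → Site (d + 2)} {j : ℕ} (h : SurgerySite ω N R j (j - m) (j + m)) :
    undo (R := R) (op ρ (N, ω) j) (undoDataOf R (N, ω) j) = (N, ω) := by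
  obtain ⟨hL, h0, hend, hP, hin⟩ := route_spec ρ h
  have hopeq := op_eq ρ h
  set σ := firstVisit R (ω j) ω h.exists_visit with hσ
  set τ := lastVisit R (ω j) ω N with hτ
  set L := ρ.len (ω j) (ω σ) (ω τ) with hLdef
  set π := ρ.path (ω j) (ω σ) (ω τ) with hπ
  have hστ : σ < τ := h.first_lt_last
  have hτN : τ ≤ N := lastVisit_le
  set ψ := splice ω σ τ L π with hψ
  have hop1 : (op ρ (N, ω) j).1 = σ + L + (N - τ) := by rw [hopeq]
  have hop2 : (op ρ (N, ω) j).2 = ψ := by rw [hopeq]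
  -- the visits of `ψ` to the cube are exactly the route times `[σ, σ + L]`
  have hvis : ∀ t, InBall R (ω j) (ψ t) ↔ σ ≤ t ∧ t ≤ σ + L := by
    intro t
    constructor
    · intro ht
      rcases le_or_gt t σ with h1 | h1
      · rcases h1.lt_or_eq with h1 | h1
        · exact absurd (by rwa [hψ, splice_of_le h1.le] at ht) (not_inBall_of_lt_firstVisit h.exists_visit h1)
        · exact ⟨h1.ge, by omega⟩
      · rcases le_or_gt t (σ + L) with h2 | h2
        · exact ⟨h1.le, h2⟩
        · obtain ⟨u, rfl⟩ : ∃ u, t = σ + L + u := ⟨t - σ - L, by omega⟩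
          rw [hψ, splice_after h0 hend] at ht
          rcases le_or_gt (τ + u) N with hu | hu
          · exact absurd ht (not_inBall_of_lastVisit_lt (by omega) hu)
          · rw [(mem_saws.1 h.mem).2.1 _ hu.le] at ht
            have hjN : τ < N := by have := h.last_spec.2; have := h.lt_N; omega
            exact absurd ht (not_inBall_of_lastVisit_lt hjN le_rfl)
    · rintro ⟨h1, h2⟩
      obtain ⟨s, rfl⟩ : ∃ s, t = σ + s := ⟨t - σ, by omega⟩
      rw [hψ, splice_piece h0 (by omega)]
      exact hin s (by omega)
  have hex : ∃ t, InBall R (ω j) (ψ t) := ⟨σ, (hvis σ).2 ⟨le_rfl, by omega⟩⟩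
  have hα : firstVisit R (ω j) ψ hex = σ := by
    classical
    unfold firstVisit
    rw [Nat.find_eq_iff]
    exact ⟨(hvis σ).2 ⟨le_rfl, by omega⟩, fun t ht hin => by have := (hvis t).1 hin; omega⟩
  have hβ : lastVisit R (ω j) ψ (σ + L + (N - τ)) = σ + L := by
    classical
    unfold lastVisit
    rw [Nat.findGreatest_eq_iff]
    refine ⟨by omega, fun _ => (hvis _).2 ⟨by omega, le_rfl⟩, fun t ht _ hin => ?_⟩
    have := (hvis t).1 hin; omega
  -- unfold `undo`
  have hdata : undoDataOf R (N, ω) j = ⟨ω j, τ - σ, fun s => ω (σ + s) - ω σ⟩ := by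
    unfold undoDataOf; simp only [dif_pos h.exists_visit]; rfl
  rw [hdata, hopeq]
  unfold undo
  simp only
  rw [dif_pos hex]
  simp only [hα, hβ]
  refine Prod.ext (by simp only; omega) ?_
  simp only
  have hψσ : ψ σ = ω σ := by rw [hψ, splice_of_le le_rfl]
  simp only [hψσ, add_sub_cancel]
  exact splice_splice hστ.le h0 hend

/-- **Decoding undoes the multi-site operation.** [cite: MadrasSlade1993, Lemma 7.2.6 (proof)] -/
theorem Decode_Phi : ∀ (js : List ℕ) {N : ℕ} {ω : ℕ → Site (d + 2)}, Valid m R N ω js →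
    Decode (R := R) (Phi ρ (N, ω) js) (dataList ρ (N, ω) js) = (N, ω)
  | [], N, ω, _ => rfl
  | j :: rest, N, ω, hv => by
    simp only [Phi, dataList, Decode]
    rw [Decode_Phi rest hv.op_cons]
    exact undo_op (hv.site j (by simp))

end PhiSpec

/-! ### Agreement of site data under early operations; the route blocks survive -/

section Blocks

variable {d : ℕ} {R : ℤ} {Λ m : ℕ} (ρ : RouteProvider d R Λ)

/-- First visits agree for walks that agree up to a time after which the visits stop. [folklore] -/
theorem firstVisit_congr {c : Site (d + 2)} {ω ω' : ℕ → Site (d + 2)} {T : ℕ} (he : ∀ t ≤ T, ω' t = ω t)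
    (h : ∃ t, InBall R c (ω t)) (h' : ∃ t, InBall R c (ω' t)) (hT : firstVisit R c ω h ≤ T) :
    firstVisit R c ω' h' = firstVisit R c ω h := by
  classical
  unfold firstVisit at hT ⊢
  rw [Nat.find_eq_iff]
  refine ⟨by rw [he _ hT]; exact Nat.find_spec h, fun t ht hin => ?_⟩
  rw [he t (by omega)] at hin
  exact Nat.find_min h ht hin

/-- Last visits agree for walks that agree up to a time after which neither visits. [folklore] -/
theorem lastVisit_congr {c : Site (d + 2)} {ω ω' : ℕ → Site (d + 2)} {T N N' : ℕ} (he : ∀ t ≤ T, ω' t = ω t)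
    (hT : lastVisit R c ω N ≤ T) (hTN : T ≤ N) (hTN' : T ≤ N')
    (hlate' : ∀ t, T < t → t ≤ N' → ¬ InBall R c (ω' t)) {t₀ : ℕ} (ht₀ : t₀ ≤ N) (hin₀ : InBall R c (ω t₀)) :
    lastVisit R c ω' N' = lastVisit R c ω N := by
  classical
  have h1 := le_lastVisit ht₀ hin₀
  have h2 : InBall R c (ω (lastVisit R c ω N)) := inBall_lastVisit ht₀ hin₀
  unfold lastVisit at hT h1 h2 ⊢
  rw [Nat.findGreatest_eq_iff]
  refine ⟨by omega, fun _ => by rw [he _ hT]; exact h2, fun t ht htN' hin => ?_⟩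
  rcases le_or_gt t T with h | h
  · rw [he t h] at hin
    exact Nat.findGreatest_is_greatest ht (by omega) hin
  · exact hlate' t h htN' hin

/-- **Site data are unchanged by an operation at a later site**: first visit, last visit, hence
entry/exit points and the route. [folklore] -/
theorem site_data_op {N : ℕ} {ω : ℕ → Site (d + 2)} {j l : ℕ}
    (hj : SurgerySite ω N R j (j - m) (j + m)) (hl : SurgerySite ω N R l (l - m) (l + m))
    (hlj : l + 2 * m + 1 ≤ j) (hap : ∃ k, 2 * R < |ω j k - ω l k|) :
    let hl' := op_preserves ρ hj hl hlj hap
    (op ρ (N, ω) j).2 l = ω l ∧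
    firstVisit R ((op ρ (N, ω) j).2 l) (op ρ (N, ω) j).2 hl'.exists_visit = firstVisit R (ω l) ω hl.exists_visit ∧
    lastVisit R ((op ρ (N, ω) j).2 l) (op ρ (N, ω) j).2 (op ρ (N, ω) j).1 = lastVisit R (ω l) ω N ∧
    (op ρ (N, ω) j).2 (firstVisit R (ω l) ω hl.exists_visit) = ω (firstVisit R (ω l) ω hl.exists_visit) ∧
    (op ρ (N, ω) j).2 (lastVisit R (ω l) ω N) = ω (lastVisit R (ω l) ω N) := by
  intro hl'
  have hσj := hj.first_spec
  have he : ∀ t ≤ l + m + 1, (op ρ (N, ω) j).2 t = ω t := fun t ht => op_apply_of_le ρ hj (by omega)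
  have hll : (op ρ (N, ω) j).2 l = ω l := he l (by omega)
  have hσl := hl.first_spec
  have hτl := hl.last_spec
  have hjN : l ≤ N := by have := hl.j_le; have := hl.lt_N; omega
  refine ⟨hll, ?_, ?_, he _ (by omega), he _ (by omega)⟩
  · have := firstVisit_congr (R := R) (c := ω l) he hl.exists_visit (by rw [← hll]; exact hl'.exists_visit) (by omega)
    convert this using 2
  · have key := lastVisit_congr (R := R) (c := ω l) (N := N) (N' := (op ρ (N, ω) j).1) he (by omega)
      (by have := hl.lt_N; omega) (by have := (op_mem_saws ρ hj).2.2.2; omega)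
      (fun t ht htN hin => by
        have := (hl'.visits t htN (by rwa [hll])).2; omega)
      hjN (show InBall R (ω l) (ω l) from fun k => by simp [hl.nonneg])
    convert key using 2

/-- **Times after a threshold survive the remaining operations, uniformly shifted.** [folklore] -/
theorem Phi_suffix : ∀ (js : List ℕ) {N : ℕ} {ω : ℕ → Site (d + 2)}, Valid m R N ω js →
    ∀ T, (∀ l ∈ js, l + m + 1 ≤ T) → T ≤ N →
    ∃ A B : ℕ, ∀ t, T ≤ t → t ≤ N → B ≤ t + A ∧ t + A - B ≤ (Phi ρ (N, ω) js).1 ∧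
      (Phi ρ (N, ω) js).2 (t + A - B) = ω t
  | [], N, ω, _, T, _, _ => ⟨0, 0, fun t _ ht => ⟨by omega, by simpa [Phi] using ht, by simp [Phi]⟩⟩
  | j :: rest, N, ω, hv, T, hT, hTN => by
    have hj := hv.site j (by simp)
    have hσ := hj.first_spec; have hτ := hj.last_spec
    have hτN : lastVisit R (ω j) ω N ≤ N := lastVisit_le
    obtain ⟨-, hafter⟩ := op_apply_route_after ρ hj
    obtain ⟨-, hl1, hl2, hl3⟩ := op_mem_saws ρ hj
    have hTj : j + m + 1 ≤ T := hT j (by simp)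
    set σ := firstVisit R (ω j) ω hj.exists_visit
    set τ := lastVisit R (ω j) ω N
    set L := ρ.len (ω j) (ω σ) (ω τ)
    have hop1 : (op ρ (N, ω) j).1 = σ + L + (N - τ) := by rw [op_eq ρ hj]
    -- apply the induction hypothesis to the operated walk with threshold `σ + L + (T - τ)`
    obtain ⟨A, B, hAB⟩ := Phi_suffix rest hv.op_cons (σ + L + (T - τ))
      (fun l hl => by have := (List.pairwise_cons.1 hv.gaps).1 l hl; omega) (by rw [hop1]; omega)
    have epair : ((op ρ (N, ω) j).1, (op ρ (N, ω) j).2) = op ρ (N, ω) j := Prod.mk.eta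
    rw [epair] at hAB
    refine ⟨σ + L + A, τ + B, fun t ht htN => ?_⟩
    obtain ⟨u, rfl⟩ : ∃ u, t = τ + u := ⟨t - τ, by omega⟩
    obtain ⟨h1, h2, h3⟩ := hAB (σ + L + u) (by omega) (by rw [hop1]; omega)
    simp only [Phi]
    refine ⟨by omega, by rwa [show τ + u + (σ + L + A) - (τ + B) = σ + L + u + A - B by omega], ?_⟩
    rw [show τ + u + (σ + L + A) - (τ + B) = σ + L + u + A - B by omega, h3, hafter u]

/-- **The route blocks survive**: for every listed site `l`, the route spliced in at `l` appears
on the final walk as a block of consecutive times. [cite: MadrasSlade1993, Lemma 7.2.6 (proof)] -/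
theorem Phi_blocks : ∀ (js : List ℕ) {N : ℕ} {ω : ℕ → Site (d + 2)} (hv : Valid m R N ω js),
    ∀ l (hl : l ∈ js),
    ∃ t₀, t₀ + ρ.len (ω l) (ω (firstVisit R (ω l) ω (hv.site l hl).exists_visit)) (ω (lastVisit R (ω l) ω N)) ≤
        (Phi ρ (N, ω) js).1 ∧
      ∀ s ≤ ρ.len (ω l) (ω (firstVisit R (ω l) ω (hv.site l hl).exists_visit)) (ω (lastVisit R (ω l) ω N)),
        (Phi ρ (N, ω) js).2 (t₀ + s) =
          ρ.path (ω l) (ω (firstVisit R (ω l) ω (hv.site l hl).exists_visit)) (ω (lastVisit R (ω l) ω N)) s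
  | [], _, _, _, l, hl => by simp at hl
  | j :: rest, N, ω, hv, l, hl => by
    have hj := hv.site j (by simp)
    rcases List.mem_cons.1 hl with rfl | hl'
    · -- the head: its block sits at `[σ, σ + L]` after the operation and survives the rest
      have hσ := hj.first_spec; have hτ := hj.last_spec
      have hτN : lastVisit R (ω l) ω N ≤ N := lastVisit_le
      obtain ⟨hroute, -⟩ := op_apply_route_after ρ hj
      obtain ⟨-, hl1, hl2, hl3⟩ := op_mem_saws ρ hj
      set σ := firstVisit R (ω l) ω hj.exists_visit
      set τ := lastVisit R (ω l) ω N
      set L := ρ.len (ω l) (ω σ) (ω τ)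
      have hop1 : (op ρ (N, ω) l).1 = σ + L + (N - τ) := by rw [op_eq ρ hj]
      obtain ⟨A, B, hAB⟩ := Phi_suffix ρ rest hv.op_cons σ
        (fun l' hl' => by have := (List.pairwise_cons.1 hv.gaps).1 l' hl'; omega) (by rw [hop1]; omega)
      have epair : ((op ρ (N, ω) l).1, (op ρ (N, ω) l).2) = op ρ (N, ω) l := Prod.mk.eta
      rw [epair] at hAB
      refine ⟨σ + A - B, ?_, fun s hs => ?_⟩
      · obtain ⟨h1, h2, -⟩ := hAB (σ + L) (by omega) (by rw [hop1]; omega)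
        obtain ⟨h1', -, -⟩ := hAB σ le_rfl (by rw [hop1]; omega)
        simp only [Phi]
        show σ + A - B + L ≤ _
        rw [show σ + A - B + L = σ + L + A - B by omega]; exact h2
      · obtain ⟨h1, h2, h3⟩ := hAB (σ + s) (by omega) (by rw [hop1]; omega)
        obtain ⟨h1', -, -⟩ := hAB σ le_rfl (by rw [hop1]; omega)
        simp only [Phi]
        rw [show σ + A - B + s = σ + s + A - B by omega, h3, hroute s hs]
    · -- a later site: its data are unchanged by the operation at `j`
      have hgaps := (List.pairwise_cons.1 hv.gaps).1 l hl'
      have hap := (List.pairwise_cons.1 hv.apart).1 l hl'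
      obtain ⟨hll, hfirst, hlast, hσe, hτe⟩ := site_data_op ρ hj (hv.site l (by simp [hl'])) hgaps hap
      obtain ⟨t₀, ht₀, hblk⟩ := Phi_blocks rest hv.op_cons l hl'
      have epair : ((op ρ (N, ω) j).1, (op ρ (N, ω) j).2) = op ρ (N, ω) j := Prod.mk.eta
      rw [epair] at ht₀ hblk
      simp only [Phi]
      refine ⟨t₀, ?_, fun s hs => ?_⟩
      · rw [hfirst, hlast] at ht₀; rw [hll, hσe, hτe] at ht₀; exact ht₀
      · have := hblk s (by rw [hfirst, hlast]; rw [hll, hσe, hτe]; exact hs)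
        rw [hfirst, hlast] at this; rw [hll, hσe, hτe] at this; exact this

end Blocks

end Literature.Probability.RandomPlanarGeometry.SAW.Zd
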